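import Mathlib
import Literature.Analysis.FluidPDE.AncientSimilarityVorticity
import Summits.NavierStokesRegularity.FluidComputer.BeltramiHostLinearisation
import HarnessLib

/-!
# The induction («vortex-dynamo») form of Navier–Stokes linearised about a Beltrami host

HONEST FRAMING (cell `ns-blowup`, seat `ns-blowup-instab`, human ruling D-0035): nothing here is
a claim about Navier–Stokes blow-up. WHAT THIS IS NOT: not a statement about the marginal tower
N1*; it is the global form of the cell's CLAIM A6 (RATE-AUDIT §6.6.4(c); pointwise-at-`x_α` form =
`BeltramiHostLinearisation.eigenmode_identity_beltrami`), an exact identity of the MODEL host.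

For a Beltrami host `U` with `Ω̄ = curl U = λ̄U`, and perturbation fields `ũ`, `ω̃ = curl ũ`, the
linearised Lamb vector is `ũ × Ω̄ + U × ω̃ = U × χ`, `χ := ω̃ − λ̄ũ` (the NON-BELTRAMI PART of the
perturbation; `cross_linearised_beltrami`, pure algebra), so the inviscid part of the linearised
vorticity equation is `curl(U × χ) = (χ·∇)U − (U·∇)χ` for divergence-free fields
(`curl_cross_eq_convect_sub_convect`, from the tree's `curl_cross_apply`; Majda–Bertozzi §1.1):

  `∂ₜ ω̃ = (χ·∇)U − (U·∇)χ + νΔω̃`,  `χ = ω̃ − λ̄ũ`   (`linearisedVorticity_induction_form`)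

— the induction operator of `U` applied to `χ`, not to `ω̃`: growth of perturbation vorticity about
a Beltrami host is sourced only by the non-Beltrami part of the perturbation (for `χ = 0` one is
back to the exactly decaying sextuplet, `BeltramiHostLinearisation.linearisedNS_strongBeltrami`); at
a stagnation point it reduces to A6 (`induction_form_at_stagnation`). This is the form quoted by the
planner in WANTED W20′(b) («linearised vorticity obeys the induction operator applied to ω̃ − λũ
for a Beltrami host»). References: A. J. Majda, A. L. Bertozzi, *Vorticity and Incompressible
Flow* (2002), §1.1, §2.3.2; cell files `instab/RATE-AUDIT.md` §6.6.4(c), `KILLSHEET.md` §XIII.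
-/

noncomputable section

open Set Real InnerProductSpace
open scoped RealInnerProductSpace

namespace Summit.NavierStokesRegularity.FluidComputer.BeltramiHostInductionForm

open Literature.Analysis.FluidPDE BeltramiHostLinearisation

/-! ### The induction form of the linearisation about a Beltrami host — A6 made global

For a Beltrami host `Ω̄ = λ̄U` the linearised Lamb vector is `ũ × Ω̄ + U × ω̃ = U × χ` with
`χ := ω̃ − λ̄ũ` the NON-BELTRAMI PART of the perturbation; hence the inviscid part of the linearised
vorticity equation, `curl(ũ × Ω̄ + U × ω̃)`, equals `curl(U × χ) = (χ·∇)U − (U·∇)χ` for divergence-free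
`U`, `χ` (tree identity `curl_cross_apply`): `∂ₜω̃ = (χ·∇)U − (U·∇)χ + νΔω̃` — the induction operator
of `U` applied to `χ`, not to `ω̃` (the «vortex-dynamo» form quoted by the planner, W20′(b)). At a
stagnation point this is A6 (`eigenmode_identity_beltrami`); for a Beltrami perturbation `χ = 0` it is
the sextuplet (§3). -/

/-- **Linearised Lamb vector about a Beltrami host**: `ũ × (λ̄U) + U × ω̃ = U × (ω̃ − λ̄ũ)`
(bilinearity and antisymmetry of the cross product; pointwise, no hypotheses). -/
theorem cross_linearised_beltrami (lam : ℝ) (U ut ωt : EuclideanSpace ℝ (Fin 3)) :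
    cross ut (lam • U) + cross U ωt = cross U (ωt - lam • ut) := by
  ext i
  fin_cases i <;> simp [cross, cross_apply] <;> ring

/-- **`curl (U × χ) = (χ·∇)U − (U·∇)χ`** at a point where `U`, `χ` are differentiable and both
divergences vanish (tree: `curl_cross_apply`, Majda–Bertozzi §1.1). -/
theorem curl_cross_eq_convect_sub_convect {U χ : EuclideanSpace ℝ (Fin 3) → EuclideanSpace ℝ (Fin 3)}
    {x : EuclideanSpace ℝ (Fin 3)} (hU : DifferentiableAt ℝ U x) (hχ : DifferentiableAt ℝ χ x)
    (hdivU : VectorCalculus.divergence U x = 0) (hdivχ : VectorCalculus.divergence χ x = 0) :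
    curl (fun y => cross (U y) (χ y)) x = convect χ U x - convect U χ x := by
  rw [curl_cross_apply hU hχ, hdivU, hdivχ, zero_smul, zero_smul, sub_zero, add_zero,
    convect_apply, convect_apply]

/-- **A6 made global — the induction form.** About a Beltrami host `U` (`curl U = λ̄U` enters only
through `Ω̄ = λ̄U`), for perturbation fields `ũ`, `ω̃` differentiable at `x` with
`div U = div ũ = div ω̃ = 0` there, the inviscid linearised vorticity nonlinearity is
`curl(ũ × λ̄U + U × ω̃) = (χ·∇)U − (U·∇)χ`, `χ = ω̃ − λ̄ũ`: growth of perturbation vorticity is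
sourced ONLY by the non-Beltrami part `χ`, transported and stretched by the host. -/
theorem linearisedVorticity_induction_form {U ut ωt : EuclideanSpace ℝ (Fin 3) → EuclideanSpace ℝ (Fin 3)}
    {x : EuclideanSpace ℝ (Fin 3)} (lam : ℝ) (hU : DifferentiableAt ℝ U x)
    (hut : DifferentiableAt ℝ ut x) (hωt : DifferentiableAt ℝ ωt x)
    (hdivU : VectorCalculus.divergence U x = 0) (hdivut : VectorCalculus.divergence ut x = 0)
    (hdivωt : VectorCalculus.divergence ωt x = 0) :
    curl (fun y => cross (ut y) (lam • U y) + cross (U y) (ωt y)) x =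
      convect (fun y => ωt y - lam • ut y) U x - convect U (fun y => ωt y - lam • ut y) x := by
  have e : (fun y => cross (ut y) (lam • U y) + cross (U y) (ωt y)) =
      fun y => cross (U y) (ωt y - lam • ut y) := funext fun y => cross_linearised_beltrami lam _ _ _
  have hsm : DifferentiableAt ℝ (fun y => lam • ut y) x := hut.const_smul lam
  have hχ : DifferentiableAt ℝ (fun y => ωt y - lam • ut y) x := hωt.sub hsm
  have hsm' : DifferentiableAt ℝ (fun y => (-lam) • ut y) x := hut.const_smul (-lam)
  have eχ : (fun y => ωt y - lam • ut y) = fun y => ωt y + (-lam) • ut y := by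
    funext y; rw [neg_smul, sub_eq_add_neg]
  have hdivχ : VectorCalculus.divergence (fun y => ωt y - lam • ut y) x = 0 := by
    rw [eχ, RingCorrector.divergence_add hωt hsm', divergence_const_smul_of_differentiableAt hut,
      hdivωt, hdivut, mul_zero, add_zero]
  rw [e, curl_cross_eq_convect_sub_convect hU hχ hdivU hdivχ]

/-- **Consistency with A6 at a stagnation point**: at `x₀` with `U(x₀) = 0` the induction form
reduces to `DU(x₀)(ω̃(x₀) − λ̄ũ(x₀))` — the right-hand side of `eigenmode_identity_beltrami`
(without the viscous remainder). -/
theorem induction_form_at_stagnation {U ut ωt : EuclideanSpace ℝ (Fin 3) → EuclideanSpace ℝ (Fin 3)}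
    {x₀ : EuclideanSpace ℝ (Fin 3)} (lam : ℝ) (hU : U x₀ = 0) :
    convect (fun y => ωt y - lam • ut y) U x₀ - convect U (fun y => ωt y - lam • ut y) x₀ =
      fderiv ℝ U x₀ (ωt x₀ - lam • ut x₀) := by
  rw [convect_apply, convect_apply, hU, map_zero, sub_zero]

end Summit.NavierStokesRegularity.FluidComputer.BeltramiHostInductionForm
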